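import Mathlib.NumberTheory.NumberField.CMField
import Literature.NumberTheory.Automorphic.HenniartAutomorphicInduction
import HarnessLib

/-!
# Regular algebraic automorphic induction over a CM field forces the inducing field to be CM
(Patrikis 2019, Rem. 2.4.8 (2); named fact, D-0014)

Topic `NumberTheory/Automorphic` (trunk AutomorphicL). Grounds the crux
`Summit.Langlands.Langlands.Theses.SelfDefeatingInduction.RegularInductionForcesCM`
(stmt-Langlands-2235) of route `Langlands/SelfDefeatingInduction`.

S. Patrikis, *Variations on a theorem of Tate*, Mem. Amer. Math. Soc. 258 (2019), no. 1238
[Patrikis2019] = arXiv:1207.6724 (held text `paper:arxiv-1207.6724`, chunk 24), §3.2 of the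
arXiv numbering (§2.4 of the memoir), **Remark 3.2.4, second bullet** (memoir: Rem. 2.4.8 (2)),
as printed:

> Let `F` be a CM field and `π` be a regular `L` or `C`-algebraic cuspidal representation of
> `GL_n(𝔸_F)`. Suppose that `π = Ind_L^F(π₀)` for some extension `L/F`. Then `L` is CM. This
> modest consequence of the proposition suggests that in the study of regular automorphic
> representations/motives/Galois representations over CM fields, we will never have to leave the
> relative comfort of this setting.

"The proposition" is Prop. `cmdescent` (memoir Prop. 2.4.7; unconditional for regular `π` by
Rem. 3.2.4 (1) and Clozel 1990 Thm. 3.13 = Thm. 3.2.1 there): the infinity type of a regular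
C- or L-algebraic cuspidal `π` over a totally imaginary field descends to the maximal CM subfield.
Patrikis's conventions (chunk 11): "By a CM field we mean as usual a quadratic totally imaginary
extension of a totally real field" — so `F` CM makes `L ⊇ F` totally imaginary and the conclusion
"`L` is CM" is Mathlib's `NumberField.IsCMField L`.

## Rendering (what is weaker than print, and why it is faithful)

* *"`π = Ind_L^F(π₀)`".* Global automorphic induction is a theorem-definition only along CYCLIC
  extensions (Arthur–Clozel 1989 Ch. 3 §6 for prime degree; Henniart 2012 [Henniart2012] in
  general), where `π₀^{L/F}` is *defined* (Henniart §1.10, (1.1)) by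
  `L(π_v, s) = ∏_{w ∣ v} L(π₀,w, s)` at almost every place `v` of `F` and is unique by
  Jacquet–Shalika rigidity. The fact is therefore stated for `L/F` Galois with cyclic Galois
  group of degree `d`, `π` cuspidal on `GL_{dn}(𝔸_F)`, `π₀` CUSPIDAL on `GL_n(𝔸_L)` (`n ≥ 1`), with
  the hypothesis "`π = Ind_L^F(π₀)`" written VERBATIM as in the tree's
  `Henniart2012_infinityType_of_automorphicInduction` (same file family): for almost every finite
  `v`, `∏_{a ∈ α_π(v)} (X - a) = ∏_{w ∣ v} ∏_{b ∈ β_{π₀}(w)} (X^{f(w|v)} - b)` on the unitary-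
  normalised Satake parameters (`AutomorphicRepData.HasSatakeParamAt`, `satakePolynomial`,
  Mathlib `HeightOneSpectrum.under`, `Ideal.inertiaDeg`). Restricting to cyclic `L/F` and cuspidal
  `π₀` only WEAKENS the printed remark ("for some extension `L/F`"); the route consumes `d = 2`.
* *"regular `L` or `C`-algebraic".* As in the tree's `Patrikis2019_cmDescent` /
  `InfinityTypeDescent`: SOME infinity type `T` of `π` (`HasInfinityType`, which pins exactly the
  multisets of `z`-exponents, Clozel 1990 §3.3) is regular (`InfinityType.IsRegular`, Clozel
  Déf. 3.12) and C- or L-algebraic (`IsCAlgebraic`/`IsLAlgebraic`, Buzzard–Gee Def. 3.1.1).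
  In particular `π.1.IsRegularAlgebraic` (Clozel: C-algebraic and regular) implies the hypothesis.
* Printed proof ("modest consequence of the proposition"), for the record and as the DISCHARGE
  PATH inside the tree: by Henniart 2012 (Thm. 3 (i), Thm. 4/5, Remarque §3.7; tree:
  `Henniart2012_infinityType_of_automorphicInduction`) the `z`-exponent multiset of `π` at
  `σ : F → ℂ` is `∑_{σ' ∣ σ}` of those of `π₀`; these sub-multisets are regular and, after the
  half-twist `π₀ ⊗ |det|^{1/2}` when needed (tree: `AlgebraicityTwist`), C- or L-algebraic, so by
  Prop. `cmdescent` (tree: `Patrikis2019_cmDescent`, proposed) they agree at any two `σ', σ''`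
  agreeing on `L_cm`; if `L` were not CM then `L_cm ⊇ F` is a proper subfield (it is CM or totally
  real and `L` is neither), two distinct extensions `σ' ≠ σ''` of one embedding of `L_cm` exist,
  and `π_σ` would have a repeated exponent (tree: `InfinityType.not_isRegular_of_map_a_eq_add_self`
  for `d = 2`), contradicting regularity.
* `K L : Type` (universe `0`) is forced by the automorphic datum, as in the Henniart file.

Nothing here duplicates a tree declaration (`lean search 'Patrikis|isCMField_of|RegularInduction'`
on 2026-08-15: only the route decl and `Patrikis2019_cmDescent` (proposal p49183)).

## References

* S. Patrikis, *Variations on a theorem of Tate*, Mem. AMS 258 (2019) no. 1238 = arXiv:1207.6724,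
  Rem. 2.4.8 (2) (memoir) = Rem. 3.2.4, bullet 2 (arXiv), with Thm. 3.2.1, Cor. 3.2.3 and Prop.
  `cmdescent`. [Patrikis2019]
* G. Henniart, *Induction automorphe globale pour les corps de nombres*, Bull. SMF 140 (2012) 1–17,
  §1.10, Thm. 3, 4, 5. [Henniart2012]
* L. Clozel, *Motifs et formes automorphes* (1990), Déf. 1.8, Déf. 3.12, Thm. 3.13. [Clozel1990]
-/

noncomputable section

open scoped NumberField Polynomial Classical
open NumberField IsDedekindDomain Polynomial Literature.NumberTheory.Automorphic

namespace Literature.NumberTheory.Automorphic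

/-- **Regular algebraic automorphic induction to a CM field comes from a CM field**
(Patrikis 2019, Rem. 2.4.8 (2) = arXiv:1207.6724 Rem. 3.2.4, second bullet: "Let `F` be a CM
field and `π` be a regular `L` or `C`-algebraic cuspidal representation of `GL_n(𝔸_F)`. Suppose
that `π = Ind_L^F(π₀)` for some extension `L/F`. Then `L` is CM."). Rendered, in the vocabulary
of `Henniart2012_infinityType_of_automorphicInduction`: for every CM number field `K`, every Galois
extension `L/K` with cyclic Galois group, of degree `d`, every `n ≥ 1`, every cuspidal `P` on
`GL_{dn}(𝔸_K)` having an infinity type that is regular and C- or L-algebraic, and every cuspidal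
`π` on `GL_n(𝔸_L)` such that `P` is automorphically induced from `π` — for almost every finite
place `v` of `K`, `∏_{a ∈ α_P(v)} (X - a) = ∏_{w ∣ v} ∏_{b ∈ β_π(w)} (X^{f(w|v)} - b)` (Henniart
2012, §1.10 (1.1), the defining property of `P ≅ π^{L/K}`) — the field `L` is CM. Restricting to
cyclic `L/K` (where global automorphic induction exists in print) and cuspidal `π` weakens the
printed remark. Named fact (D-0014); printed proof: Henniart's archimedean components + Prop.
`cmdescent` (Clozel Thm. 3.13), see the module docstring.
[cite: Patrikis2019, Rem. 2.4.8 (2) (= arXiv:1207.6724 Rem. 3.2.4, bullet 2)]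
[cite: Henniart2012, §1.10] -/
def Patrikis2019_isCMField_of_regular_automorphicInduction : Prop :=
  ∀ (K L : Type) [Field K] [NumberField K] [Field L] [NumberField L] [Algebra K L]
    [IsGalois K L], IsCyclic (L ≃ₐ[K] L) → IsCMField K →
    ∀ (n d : ℕ), 0 < n → Module.finrank K L = d →
    ∀ (hK : isCompact_glFiniteIntegralLevel (d * n) K) (hL : isCompact_glFiniteIntegralLevel n L)
      (P : CuspidalAutomorphicRepData (d * n) K hK) (π : CuspidalAutomorphicRepData n L hL),
      (∃ T : InfinityType K (d * n),
        P.1.HasInfinityType T ∧ T.IsRegular ∧ (T.IsCAlgebraic ∨ T.IsLAlgebraic)) →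
      (∀ᶠ v : HeightOneSpectrum (𝓞 K) in Filter.cofinite,
        ∃ (α : Multiset ℂ) (β : HeightOneSpectrum (𝓞 L) → Multiset ℂ),
          P.1.HasSatakeParamAt v α ∧
          (∀ w : HeightOneSpectrum (𝓞 L), w.under (𝓞 K) = v → π.1.HasSatakeParamAt w (β w)) ∧
          satakePolynomial α =
            ∏ᶠ w ∈ {w : HeightOneSpectrum (𝓞 L) | w.under (𝓞 K) = v},
              (satakePolynomial (β w)).comp (X ^ w.asIdeal.inertiaDeg (𝓞 K))) →
      IsCMField L

/-- Unfolding lemma for `Patrikis2019_isCMField_of_regular_automorphicInduction`. [folklore] -/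
theorem Patrikis2019_isCMField_of_regular_automorphicInduction_iff :
    Patrikis2019_isCMField_of_regular_automorphicInduction ↔
      ∀ (K L : Type) [Field K] [NumberField K] [Field L] [NumberField L] [Algebra K L]
        [IsGalois K L], IsCyclic (L ≃ₐ[K] L) → IsCMField K →
        ∀ (n d : ℕ), 0 < n → Module.finrank K L = d →
        ∀ (hK : isCompact_glFiniteIntegralLevel (d * n) K)
          (hL : isCompact_glFiniteIntegralLevel n L)
          (P : CuspidalAutomorphicRepData (d * n) K hK) (π : CuspidalAutomorphicRepData n L hL),
          (∃ T : InfinityType K (d * n),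
            P.1.HasInfinityType T ∧ T.IsRegular ∧ (T.IsCAlgebraic ∨ T.IsLAlgebraic)) →
          (∀ᶠ v : HeightOneSpectrum (𝓞 K) in Filter.cofinite,
            ∃ (α : Multiset ℂ) (β : HeightOneSpectrum (𝓞 L) → Multiset ℂ),
              P.1.HasSatakeParamAt v α ∧
              (∀ w : HeightOneSpectrum (𝓞 L), w.under (𝓞 K) = v →
                π.1.HasSatakeParamAt w (β w)) ∧
              satakePolynomial α =
                ∏ᶠ w ∈ {w : HeightOneSpectrum (𝓞 L) | w.under (𝓞 K) = v},
                  (satakePolynomial (β w)).comp (X ^ w.asIdeal.inertiaDeg (𝓞 K))) →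
          IsCMField L :=
  Iff.rfl

/-- **The quadratic case, in the shape of the crux `RegularInductionForcesCM`** (route
`Langlands/SelfDefeatingInduction`, stmt-Langlands-2235): `K` CM, `L/K` of degree `2` and NOT CM,
`P` cuspidal on `GL_{2n}(𝔸_K)` automorphically induced (a.e. Satake relation) from a cuspidal `π`
on `GL_n(𝔸_L)`; then `P` is not regular algebraic. A quadratic extension of number fields is
Galois with cyclic group (Mathlib `Algebra.IsQuadraticExtension.isGalois/isCyclic`), and
`IsRegularAlgebraic` (Clozel: C-algebraic and regular infinity type) is the hypothesis of the fact,
so this is the contrapositive of the fact at `d = 2`.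
[cite: Patrikis2019, Rem. 2.4.8 (2) (= arXiv:1207.6724 Rem. 3.2.4, bullet 2)] -/
theorem Patrikis2019_isCMField_of_regular_automorphicInduction.not_isRegularAlgebraic_quadratic
    (h : Patrikis2019_isCMField_of_regular_automorphicInduction)
    (K L : Type) [Field K] [NumberField K] [Field L] [NumberField L] [Algebra K L]
    (hKcm : IsCMField K) (hLcm : ¬ IsCMField L) (hd : Module.finrank K L = 2) (n : ℕ) (hn : 0 < n)
    (hK : isCompact_glFiniteIntegralLevel (2 * n) K) (hL : isCompact_glFiniteIntegralLevel n L)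
    (P : CuspidalAutomorphicRepData (2 * n) K hK) (π : CuspidalAutomorphicRepData n L hL)
    (hAI : ∀ᶠ v : HeightOneSpectrum (𝓞 K) in Filter.cofinite,
      ∃ (α : Multiset ℂ) (β : HeightOneSpectrum (𝓞 L) → Multiset ℂ),
        P.1.HasSatakeParamAt v α ∧
        (∀ w : HeightOneSpectrum (𝓞 L), w.under (𝓞 K) = v → π.1.HasSatakeParamAt w (β w)) ∧
        satakePolynomial α =
          ∏ᶠ w ∈ {w : HeightOneSpectrum (𝓞 L) | w.under (𝓞 K) = v},
            (satakePolynomial (β w)).comp (X ^ w.asIdeal.inertiaDeg (𝓞 K))) :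
    ¬ P.1.IsRegularAlgebraic := by
  intro hreg
  haveI : Algebra.IsQuadraticExtension K L := ⟨hd⟩
  haveI : Module.Finite K L := Module.Finite.of_restrictScalars_finite ℚ K L
  haveI : Algebra.IsSeparable K L := Algebra.IsSeparable.of_integral K L
  haveI : IsGalois K L := Algebra.IsQuadraticExtension.isGalois K L
  obtain ⟨T, hT, hCalg, hTreg⟩ := hreg
  exact hLcm (h K L (Algebra.IsQuadraticExtension.isCyclic K L) hKcm n 2 hn hd hK hL P π
    ⟨T, hT, hTreg, Or.inl hCalg⟩ hAI)

end Literature.NumberTheory.Automorphic
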